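import Summits.AnomalousDissipation.AnomalousDissipation.Theorems.SolenoidalFractalHomogenisationLagrangianStepOneLevelSplitDefsL
import HarnessLib

/-!
# K1L_D `LagrangianRenormalisationStepDesign` (stmt-AnomalousDissipation-27980), stub `stub_windowDefectL` (S23″ of registry v3-cut-2): the WINDOW
# STRUCTURE of `gridL` (helper; `--supports stmt-AnomalousDissipation-27980 --as helper`)

Sequel of `…LagrangianStepOneLevelSplitApiL` (p653511), namespace `…LagrangianStep.OneLevelSplit`.  With `F := ⌊t/r⌋₊` (`0 < r`) the grid
`gridL r t` of `…OneLevelSplitDefsL` (p653233) is: `gridL r t k = k·r` for `k + 1 ≤ F` (`gridL_eq_mul_of_succ_le_floor`), `gridL r t k = t` for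
`F ≤ k`, `k ≠ 0` (`gridL_eq_of_floor_le`); hence the windows `[gridL k, gridL (k+1)]` are: UNIFORM of length `r` for `k + 2 ≤ F`
(`gridL_succ_sub_eq_of_lt`), the LAST GENUINE window `[(F−1)r, t]` of length `t − (F−1)r ∈ [r, 2r)` at `k = F − 1` when `F ≥ 1` (`gridL_floor_sub`),
and DEGENERATE (`gridL (k+1) = gridL k = t`) for `F ≤ k ≠ 0` (`gridL_succ_eq_of_floor_le`).  This is the case split the S23″ prover assembles the
per-window decomposition on (lead 17:32:54Z implementation note: uniform windows = aligned insertion windows of level `m+1`; the merged last window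
spans two; degenerate windows carry `e_j = g_j = 0`).  Elementary; no sorry; nothing about the crux, Onsager's conjecture or anomalous dissipation is
claimed.  Text by planner seat `ad-ideate-p4` g11 (2026-08-28); landed by a prover seat (Summits/Theorems is prover-only, D-0016).
-/

set_option linter.dupNamespace false

noncomputable section

namespace Summit.AnomalousDissipation.AnomalousDissipation.Theorems.SolenoidalFractalHomogenisation.LagrangianStep

namespace OneLevelSplit

/-- Before the floor index the grid is uniform: `gridL r t k = k·r` whenever `k + 1 ≤ ⌊t/r⌋₊` (`0 < r`). -/
theorem gridL_eq_mul_of_succ_le_floor {r t : ℝ} (hr : 0 < r) {k : ℕ} (hk : k + 1 ≤ ⌊t / r⌋₊) :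
    gridL r t k = (k : ℝ) * r := by
  unfold gridL
  by_cases hk0 : k = 0
  · simp [hk0]
  · have hF : 0 < ⌊t / r⌋₊ := by omega
    have ht : 0 < t := by
      have := Nat.floor_pos.mp hF
      have : 0 < t / r := by linarith
      exact (div_pos_iff_of_pos_right hr).mp this
    have hle : ((k : ℝ) + 1) * r ≤ t := by
      have h1 : ((k : ℝ) + 1) ≤ (⌊t / r⌋₊ : ℝ) := by exact_mod_cast hk
      have h2 : (⌊t / r⌋₊ : ℝ) ≤ t / r := Nat.floor_le (div_nonneg ht.le hr.le)
      have h3 : ((k : ℝ) + 1) * r ≤ (t / r) * r := mul_le_mul_of_nonneg_right (h1.trans h2) hr.le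
      rwa [div_mul_cancel₀ t hr.ne'] at h3
    simp [hk0, hle]

/-- From the floor index on the grid sits at `t`: `gridL r t k = t` whenever `⌊t/r⌋₊ ≤ k` and `k ≠ 0` (`0 < r`). -/
theorem gridL_eq_of_floor_le {r t : ℝ} (hr : 0 < r) {k : ℕ} (hk0 : k ≠ 0) (hk : ⌊t / r⌋₊ ≤ k) :
    gridL r t k = t := by
  unfold gridL
  have hlt : ¬ ((k : ℝ) + 1) * r ≤ t := by
    intro h
    have h1 : t / r < (⌊t / r⌋₊ : ℝ) + 1 := Nat.lt_floor_add_one (t / r)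
    have h2 : (⌊t / r⌋₊ : ℝ) + 1 ≤ (k : ℝ) + 1 := by exact_mod_cast Nat.add_le_add_right hk 1
    have h3 : t / r < (k : ℝ) + 1 := h1.trans_le h2
    have h4 : t < ((k : ℝ) + 1) * r := by
      have := mul_lt_mul_of_pos_right h3 hr
      rwa [div_mul_cancel₀ t hr.ne'] at this
    linarith
  simp [hk0, hlt]

/-- The uniform windows: for `k + 2 ≤ ⌊t/r⌋₊`, `gridL r t (k+1) − gridL r t k = r`. -/
theorem gridL_succ_sub_eq_of_lt {r t : ℝ} (hr : 0 < r) {k : ℕ} (hk : k + 2 ≤ ⌊t / r⌋₊) :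
    gridL r t (k + 1) - gridL r t k = r := by
  rw [gridL_eq_mul_of_succ_le_floor hr (k := k + 1) (by omega), gridL_eq_mul_of_succ_le_floor hr (k := k) (by omega)]
  push_cast; ring

/-- The LAST genuine window `[(F−1)r, t]`, `F = ⌊t/r⌋₊ ≥ 1`: its length is `t − (F−1)·r ∈ [r, 2r)`. -/
theorem gridL_floor_sub {r t : ℝ} (hr : 0 < r) (hF : 1 ≤ ⌊t / r⌋₊) :
    gridL r t ⌊t / r⌋₊ - gridL r t (⌊t / r⌋₊ - 1) = t - ((⌊t / r⌋₊ : ℝ) - 1) * r ∧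
      r ≤ t - ((⌊t / r⌋₊ : ℝ) - 1) * r ∧ t - ((⌊t / r⌋₊ : ℝ) - 1) * r < 2 * r := by
  have hF0 : ⌊t / r⌋₊ ≠ 0 := by omega
  rw [gridL_eq_of_floor_le hr hF0 le_rfl, gridL_eq_mul_of_succ_le_floor hr (k := ⌊t / r⌋₊ - 1) (by omega)]
  have hcast : ((⌊t / r⌋₊ - 1 : ℕ) : ℝ) = (⌊t / r⌋₊ : ℝ) - 1 := by
    rw [Nat.cast_sub hF, Nat.cast_one]
  have ht : 0 ≤ t := by
    have := Nat.floor_pos.mp (by omega : 0 < ⌊t / r⌋₊)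
    have : 0 < t / r := by linarith
    exact ((div_pos_iff_of_pos_right hr).mp this).le
  have h1 : (⌊t / r⌋₊ : ℝ) ≤ t / r := Nat.floor_le (div_nonneg ht hr.le)
  have h2 : t / r < (⌊t / r⌋₊ : ℝ) + 1 := Nat.lt_floor_add_one (t / r)
  have h1' : (⌊t / r⌋₊ : ℝ) * r ≤ t := by
    have := mul_le_mul_of_nonneg_right h1 hr.le; rwa [div_mul_cancel₀ t hr.ne'] at this
  have h2' : t < ((⌊t / r⌋₊ : ℝ) + 1) * r := by
    have := mul_lt_mul_of_pos_right h2 hr; rwa [div_mul_cancel₀ t hr.ne'] at this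
  refine ⟨by rw [hcast], ?_, ?_⟩
  · nlinarith [h1']
  · nlinarith [h2']

/-- Degenerate windows: for `⌊t/r⌋₊ ≤ k`, `k ≠ 0`, `gridL r t (k+1) = gridL r t k` (`= t`). -/
theorem gridL_succ_eq_of_floor_le {r t : ℝ} (hr : 0 < r) {k : ℕ} (hk0 : k ≠ 0) (hk : ⌊t / r⌋₊ ≤ k) :
    gridL r t (k + 1) = gridL r t k := by
  rw [gridL_eq_of_floor_le hr hk0 hk, gridL_eq_of_floor_le hr (Nat.succ_ne_zero k) (by omega)]

end OneLevelSplit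

end Summit.AnomalousDissipation.AnomalousDissipation.Theorems.SolenoidalFractalHomogenisation.LagrangianStep

end
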